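import Summits.HodgeConjecture.HodgeConjecture.Theorems.HeckePrymWeilHeckePrymAnchorsOfLevelStructure
import Literature.AlgebraicGeometry.HodgeTheory.InvariantClassesFromTotalSpaceHolds
import HarnessLib

/-!
# Every `ℚ(√-p)` Hodge–Weil rung from Deligne's level-`n` family and Weil-variational Hodge — no anchors item, no descent

Route `HeckePrymWeil` (sub-problem `HodgeConjecture`); lead seat c4 of crux `WeilTwelvefoldsSqrtMinus7`
(stmt-HodgeConjecture-1261), line `isotypic-unimodular-saturation`, reshape r3 ("tensor anchor").

The rung predicate `HWA(p, k)` of the route (`HodgeWeilLadder`, `WeilDescending`, the three rung cruxes):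
on every complex abelian `2k`-fold `(A, φ)` with `φ ≫ φ = -p` every rational `(k,k)`-class of the typed
Weil plane `Eig((𝟙+φ)^*, (1+i√p)^{2k}) ⊔ Eig((𝟙+φ)^*, (1-i√p)^{2k})` is algebraic.

MAIN THEOREM `hodgeWeil_of_transport_of_sections`: `HWA(p, k)` (every prime `p ≡ 3 (4)`, `p ≥ 7`,
every `k ≥ 1`) follows from
* the W-engine `hG` (a continuous section of `R^{2k} f_* ℂ` over a smooth irreducible quasi-projective
  base of an embedded smooth projective family is the global section of one class of the total space —
  DISCHARGED in the tree: `stub_globalClassOfSection_of_leray deligne1968_invariantClass_fromTotalSpace_holds`),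
* Deligne's Weil family THROUGH `A` ITSELF with its flat, fibrewise Hodge, Weil section through the
  class `c` and a tensor-split fibre (`deligne1982_weilFamily_hodgeWeilSection`, a THEOREM of the one
  named fact `deligne1982_weilFamily_levelStructure` = Deligne's level-`n` abelian scheme with
  `𝒪_K`-action, [Deligne1982HodgeCycles, proof of Thm. 4.8]; `WeilFamilyLevelStructure`), and
* TRANSPORT at `(p, k)` ONLY: variational Hodge for rational `(k,k)` classes along smooth projective
  families of `√-p`-abelian `2k`-folds over a smooth irreducible base (= `WeilVariationalHodge`,
  stmt-HodgeConjecture-14497, at `M = k`),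
by: upgrade `c ≠ 0` to the strong plane (`stub_upgrade`), take the family `f : 𝒳 → S` through
`A ≅ 𝒳_{s₁}` and the flat section `σ` through `c`, globalise `σ` to `W ∈ H^{2k}(𝒳(ℂ); ℂ)` (`hG`), read
rationality along the section (`stub_rationalAlongSection`) and Hodge type `(k,k)` from clause (a),
algebraicity at the tensor-split fibre `𝒳_{s₀} ≅ Y ~ A₁ × A₁` from Deligne's tensor-point anchor
(`owf_anchorAlgebraic` = `stub_pointClassAnchor` across `stub_isogenyTransfer`, [Deligne1982HodgeCycles,
Lemma 4.5, Remark 4.10]), transport to `s₁`, and return along `e : A ≅ 𝒳_{s₁}` (iso-invariance).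

Compared with the landed chains this removes, from the trust base of the route's whole `ℚ(√-p)` sector:
the reach fact `weilFamily_hyperbolic_weilSystem_reach` (Landherr classification, hyperbolic components
only; `HeckePrymWeilCmLadderReach`, lead c3), the aiming to dimension `2k+2` with its CM partner square
and the descent back (`AimedDescending`, `stub_descent`), the CM anchor tower, and — against the
route's glue `LadderGlue` — the crux `HeckePrymAnchors` (stmt-14496) and the open support
`ProductDescent` (stmt-14498): COROLLARIES `hodgeWeil_of_weilVariationalHodge_of_levelStructure`
(`M3 → WeilVariationalHodge → ∀ p k, HWA(p,k)`), hence the target `HodgeWeilLadder` (stmt-1259), the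
rungs `WeilSixfoldsSqrtMinus7` (1260), `WeilTwelvefoldsSqrtMinus7` (1261), `WeilTenfoldsSqrtMinus11`
(1262), the split child `HyperbolicEightfoldsSqrtMinus7` (14642), and the summit GIVEN the off-sector
conjunct: `hodgeConjecture_of_levelStructure_of_weilVariationalHodge_of_offWeilSector`
(`M3 → WeilVariationalHodge → SummitOffWeilSector → HodgeConjecture`).  The open content is unchanged
and sharp: `WeilVariationalHodge` (Grothendieck's variational Hodge statement for Weil families;
HC-implied, André-motivated, irrefutable in the tree).  No definition, no `sorry`.
-/

noncomputable section

-- every declaration of this problem lives in `Summit.HodgeConjecture.HodgeConjecture.…` (summit = sub-problem)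
set_option linter.dupNamespace false

open CategoryTheory AlgebraicGeometry Limits MonoidalCategory CartesianMonoidalCategory

namespace Summit.HodgeConjecture.HodgeConjecture.Theorems.HeckePrymWeilLine

open Literature.AlgebraicGeometry Literature.AlgebraicGeometry.Motives Literature.AlgebraicGeometry.HodgeTheory
open Summit.HodgeConjecture.HodgeConjecture.Theses.HeckePrymWeil

/-- **`HWA(p, k)` from the W-engine, Deligne's Weil family through `A` with fibrewise Hodge flat Weil
section, and transport at `(p, k)`.**  For a prime `p ≡ 3 (4)`, `p ≥ 7`, and `k ≥ 1`: if `hG`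
globalises continuous sections of `R^{2k} f_* ℂ`, `hWF` is Deligne's family package
`deligne1982_weilFamily_hodgeWeilSection`, and `hT` transports algebraicity of rational `(k,k)` global
classes along smooth projective families of `√-p`-abelian `2k`-folds over smooth irreducible bases from
one fibre to all, then every rational `(k,k)`-class of the typed Weil plane of every `√-p`-abelian
`2k`-fold `(A, φ)` is algebraic.  Proof in the module docstring (family through `A` itself; anchor =
the tensor-split fibre, algebraic by `owf_anchorAlgebraic`; no aiming, no descent).
[cite: Deligne1982HodgeCycles, proof of Thm. 4.8 (pp. 47–52) with Prop. 4.4, Lemma 4.5, Remark 4.10]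
[cite: vanGeemen1994HodgeAV, §5.3–5.11] [cite: Grothendieck1966, footnote 13] -/
theorem hodgeWeil_of_transport_of_sections
    (hG : ∀ ⦃𝒳 S : SchemeOver ℂ⦄ (f : 𝒳 ⟶ S) (n k : ℕ), IsSmoothProjectiveFamily f n →
      (∃ (N : ℕ) (ι : 𝒳 ⟶ projectiveSpace N ℂ ⊗ S), IsClosedImmersion ι.left ∧
        ι ≫ snd (projectiveSpace N ℂ) S = f) →
      AlgebraicGeometry.Smooth S.hom → IsQuasiProjectiveOver S → IrreducibleSpace S.left →
      ∀ (σ : ComplexPoints S → FiberClass f k), Continuous σ → (∀ s, (σ s).pt = s) →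
        ∃ W : complexBetti 𝒳 k, ∀ s, σ s = globalSection f k W s)
    (hWF : deligne1982_weilFamily_hodgeWeilSection)
    {p : ℕ} (hp : p.Prime) (hp4 : p % 4 = 3) (hp7 : 7 ≤ p) {k : ℕ} (hk : 1 ≤ k)
    (hT : ∀ ⦃𝒳 S : SchemeOver ℂ⦄ (f : 𝒳 ⟶ S), IsSmoothProjectiveFamily f (2 * k) →
      IrreducibleSpace S.left → AlgebraicGeometry.Smooth S.hom →
      ∀ (W : complexBetti 𝒳 (2 * k)),
        (∀ s : ComplexPoints S, IsRationalClass (complexBetti.map (fiberι f s) (2 * k) W) ∧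
          IsOfHodgeType (2 * k) (fiberOver f s) (2 * k) k k (complexBetti.map (fiberι f s) (2 * k) W)) →
        (∀ s : ComplexPoints S, ∃ (A' : AbelianVariety ℂ) (φ' : A' ⟶ A'),
          A'.dim = 2 * k ∧ φ' ≫ φ' = -((p : ℤ) • 𝟙 A') ∧ Nonempty (A'.X ≅ fiberOver f s)) →
        (∃ s₀ : ComplexPoints S,
          complexBetti.map (fiberι f s₀) (2 * k) W ∈ algebraicClasses (fiberOver f s₀) k) →
        ∀ s : ComplexPoints S,
          complexBetti.map (fiberι f s) (2 * k) W ∈ algebraicClasses (fiberOver f s) k) :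
    ∀ (A : AbelianVariety ℂ) (φ : A ⟶ A), A.dim = 2 * k → φ ≫ φ = -((p : ℤ) • 𝟙 A) →
      ∀ c : complexBetti A.X (2 * k), IsRationalClass c → IsOfHodgeType (2 * k) A.X (2 * k) k k c →
        c ∈ Module.End.eigenspace (complexBetti.map (𝟙 A + φ).hom.hom.hom (2 * k)).hom
              ((1 + Complex.I * (Real.sqrt (p : ℝ) : ℂ)) ^ (2 * k)) ⊔
            Module.End.eigenspace (complexBetti.map (𝟙 A + φ).hom.hom.hom (2 * k)).hom
              ((1 - Complex.I * (Real.sqrt (p : ℝ) : ℂ)) ^ (2 * k)) →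
        c ∈ algebraicClasses A.X k := by
  intro A φ hA hφ c hrat hH hW
  -- the zero class is algebraic
  by_cases h0 : c = 0
  · rw [h0]
    exact Submodule.zero_mem _
  -- typing upgrade: `c` lies in the strong Weil plane of `(A, φ)`
  have hcW := stub_upgrade p hp hp4 hp7 k A φ hA hφ hW
  -- Deligne's Weil family THROUGH `A`, its flat fibrewise-Hodge Weil section through `c`,
  -- and the tensor-split fibre over `s₀`
  obtain ⟨𝒳, S, f, s₁, s₀, e, σ, hfam, hι, hirr, hsm, hSqp, hfib, hσ, hpt, hHσ, hs₁, Y, Ψ, e₀, x,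
    ⟨A₁, f₁, g₁, m, hA₁, hY, hΨ, hm, hfg, hf, hg⟩, hs₀, hx⟩ :=
    hWF p hp hp4 hp7 k hk A φ hA hφ c hcW h0 hrat hH
  -- the global class of the section (W-engine)
  obtain ⟨W, hWσ⟩ := hG f (2 * k) (2 * k) hfam hι hsm hSqp hirr σ hσ hpt
  have hcls : ∀ (s : ComplexPoints S) (y : complexBetti (fiberOver f s) (2 * k)),
      σ s = ⟨s, y⟩ → complexBetti.map (fiberι f s) (2 * k) W = y := by
    intro s y hy
    have h := (hWσ s).symm.trans hy
    simp only [globalSection, FiberClass.mk.injEq, heq_eq_eq, true_and] at h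
    exact h
  have hW₁ : complexBetti.map (fiberι f s₁) (2 * k) W = complexBetti.map e.inv (2 * k) c :=
    hcls s₁ _ hs₁
  have hW₀ : complexBetti.map (fiberι f s₀) (2 * k) W = x := hcls s₀ x hs₀
  -- rationality along the section (proved), Hodge type `(k,k)` from the family's clause (a)
  have hrat₁ : IsRationalClass (σ s₁).cls := by
    rw [hs₁]; exact hrat.map _
  have hratσ : ∀ s, IsRationalClass (σ s).cls :=
    stub_rationalAlongSection f (2 * k) (2 * k) hfam hsm hSqp hirr σ hσ hpt s₁ hrat₁
  have hfibre : ∀ s : ComplexPoints S, IsRationalClass (complexBetti.map (fiberι f s) (2 * k) W) ∧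
      IsOfHodgeType (2 * k) (fiberOver f s) (2 * k) k k (complexBetti.map (fiberι f s) (2 * k) W) := by
    intro s
    have h₁ := hratσ s
    have h₂ := hHσ s
    rw [hWσ s] at h₁ h₂
    exact ⟨h₁, h₂⟩
  -- the anchor: `W|_{𝒳_{s₀}}` is algebraic (Deligne's tensor point across the isogeny pair)
  have halg₀ : complexBetti.map (fiberι f s₀) (2 * k) W ∈ algebraicClasses (fiberOver f s₀) k := by
    rw [hW₀]
    exact owf_isoTransport _ Y e₀ k x
      (owf_anchorAlgebraic hp hp4 hp7 A₁ f₁ g₁ m hA₁ hY hΨ hm hfg hf hg hx)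
  -- transport to the fibre over `s₁`
  have halg₁ : complexBetti.map (fiberι f s₁) (2 * k) W ∈ algebraicClasses (fiberOver f s₁) k :=
    hT f hfam hirr hsm W hfibre hfib ⟨s₀, halg₀⟩ s₁
  -- return along `e : A ≅ 𝒳_{s₁}`
  have key := mem_algebraicClasses_map_of_iso (p := k) (hfam.isSmoothProjective s₁)
    (AbelianVariety.isSmoothProjective_holds (A := A)) e halg₁
  rw [hW₁, ← CategoryTheory.comp_apply, ← complexBetti.map_comp, Iso.hom_inv_id,
    complexBetti.map_id] at key
  exact key

/-- **`HWA(p, k)` for every `p ≡ 3 (4)` prime `≥ 7` and every `k ≥ 1`, from Deligne's Weil family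
package and `WeilVariationalHodge`** (CONDITIONAL result: the named fact
`deligne1982_weilFamily_hodgeWeilSection` and the open crux stmt-HodgeConjecture-14497).  The W-engine
is the tree's `deligne1968_invariantClass_fromTotalSpace_holds` through `stub_globalClassOfSection_of_leray`;
the transport at `(p, k)` is `WeilVariationalHodge` at `M = k`.
[cite: Deligne1982HodgeCycles, proof of Thm. 4.8 (pp. 47–52) with Prop. 4.4, Lemma 4.5, Remark 4.10]
[cite: Grothendieck1966, footnote 13] -/
theorem hodgeWeil_of_weilVariationalHodge_of_hodgeWeilSection
    (hWF : deligne1982_weilFamily_hodgeWeilSection) (hV : WeilVariationalHodge) :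
    ∀ p : ℕ, p.Prime → p % 4 = 3 → 7 ≤ p → ∀ k : ℕ, 1 ≤ k →
    ∀ (A : AbelianVariety ℂ) (φ : A ⟶ A), A.dim = 2 * k → φ ≫ φ = -((p : ℤ) • 𝟙 A) →
      ∀ c : complexBetti A.X (2 * k), IsRationalClass c → IsOfHodgeType (2 * k) A.X (2 * k) k k c →
        c ∈ Module.End.eigenspace (complexBetti.map (𝟙 A + φ).hom.hom.hom (2 * k)).hom
              ((1 + Complex.I * (Real.sqrt (p : ℝ) : ℂ)) ^ (2 * k)) ⊔
            Module.End.eigenspace (complexBetti.map (𝟙 A + φ).hom.hom.hom (2 * k)).hom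
              ((1 - Complex.I * (Real.sqrt (p : ℝ) : ℂ)) ^ (2 * k)) →
        c ∈ algebraicClasses A.X k :=
  fun _p hp hp4 hp7 k hk =>
    hodgeWeil_of_transport_of_sections
      (stub_globalClassOfSection_of_leray deligne1968_invariantClass_fromTotalSpace_holds) hWF hp hp4 hp7
      hk (hV _ hp hp4 hp7 k hk)

/-- **`HWA(p, k)` for every `p ≡ 3 (4)` prime `≥ 7` and every `k ≥ 1`, from Deligne's level-`n`
abelian scheme with `𝒪_K`-action (`deligne1982_weilFamily_levelStructure`, the bare construction:
no analytic or Hodge-theoretic clause) and `WeilVariationalHodge`** (CONDITIONAL result).  The flat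
fibrewise-Hodge Weil section is the tree's theorem `deligne1982_weilFamily_hodgeWeilSection_of_levelStructure`.
[cite: Deligne1982HodgeCycles, proof of Thm. 4.8 (the group Γ, n ≥ 3) with Thm. 2.15 and Prop. 4.4]
[cite: Grothendieck1966, footnote 13] -/
theorem hodgeWeil_of_weilVariationalHodge_of_levelStructure
    (hLS : deligne1982_weilFamily_levelStructure) (hV : WeilVariationalHodge) :
    ∀ p : ℕ, p.Prime → p % 4 = 3 → 7 ≤ p → ∀ k : ℕ, 1 ≤ k →
    ∀ (A : AbelianVariety ℂ) (φ : A ⟶ A), A.dim = 2 * k → φ ≫ φ = -((p : ℤ) • 𝟙 A) →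
      ∀ c : complexBetti A.X (2 * k), IsRationalClass c → IsOfHodgeType (2 * k) A.X (2 * k) k k c →
        c ∈ Module.End.eigenspace (complexBetti.map (𝟙 A + φ).hom.hom.hom (2 * k)).hom
              ((1 + Complex.I * (Real.sqrt (p : ℝ) : ℂ)) ^ (2 * k)) ⊔
            Module.End.eigenspace (complexBetti.map (𝟙 A + φ).hom.hom.hom (2 * k)).hom
              ((1 - Complex.I * (Real.sqrt (p : ℝ) : ℂ)) ^ (2 * k)) →
        c ∈ algebraicClasses A.X k :=
  hodgeWeil_of_weilVariationalHodge_of_hodgeWeilSection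
    (deligne1982_weilFamily_hodgeWeilSection_of_levelStructure hLS) hV

/-! ### Route-level corollaries: target, rungs, split child, and the summit given the off-sector conjunct -/

/-- **The route TARGET `HodgeWeilLadder` (stmt-HodgeConjecture-1259) from `M3` and
`WeilVariationalHodge`** — rung `(p, g)` is `HWA(p, (p-1)/2·(g-1))` and `(p-1)/2·(g-1) ≥ 3 ≥ 1`.
Against the route's glue `LadderGlue` this needs neither `HeckePrymAnchors` nor `ProductDescent` nor
`WeilDescending`. [cite: Deligne1982HodgeCycles, proof of Thm. 4.8] [cite: Grothendieck1966, footnote 13] -/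
theorem hodgeWeilLadder_of_weilVariationalHodge_of_levelStructure
    (hLS : deligne1982_weilFamily_levelStructure) (hV : WeilVariationalHodge) : HodgeWeilLadder := by
  intro p hp hp4 hp7 g hg n hn A φ hA hφ c hrat hH hW
  have hn1 : 1 ≤ n := by have := owf_three_le_k hp7 hg hn; omega
  exact hodgeWeil_of_weilVariationalHodge_of_levelStructure hLS hV p hp hp4 hp7 n hn1 A φ hA hφ c hrat hH hW

/-- **Rung `(7, 2)`: `WeilSixfoldsSqrtMinus7` (stmt-HodgeConjecture-1260) from `M3` and
`WeilVariationalHodge`** (`HWA(7, 3)`). [cite: Deligne1982HodgeCycles, proof of Thm. 4.8] -/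
theorem weilSixfoldsSqrtMinus7_of_weilVariationalHodge_of_levelStructure
    (hLS : deligne1982_weilFamily_levelStructure) (hV : WeilVariationalHodge) : WeilSixfoldsSqrtMinus7 := by
  intro A φ hA hφ c hrat hH hW
  exact hodgeWeil_of_weilVariationalHodge_of_levelStructure hLS hV 7 (by norm_num) (by norm_num) le_rfl
    3 (by norm_num) A φ hA (by exact_mod_cast hφ) c hrat hH (by exact_mod_cast hW)

/-- **Rung `(7, 3)`: the crux `WeilTwelvefoldsSqrtMinus7` (stmt-HodgeConjecture-1261) from `M3` and
`WeilVariationalHodge`** (`HWA(7, 6)`; transport used at `(p, M) = (7, 6)` only — the family of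
twelvefolds through `A` itself). [cite: Deligne1982HodgeCycles, proof of Thm. 4.8] -/
theorem weilTwelvefoldsSqrtMinus7_of_weilVariationalHodge_of_levelStructure
    (hLS : deligne1982_weilFamily_levelStructure) (hV : WeilVariationalHodge) :
    WeilTwelvefoldsSqrtMinus7 := by
  intro A φ hA hφ c hrat hH hW
  exact hodgeWeil_of_weilVariationalHodge_of_levelStructure hLS hV 7 (by norm_num) (by norm_num) le_rfl
    6 (by norm_num) A φ hA (by exact_mod_cast hφ) c hrat hH (by exact_mod_cast hW)

/-- **Rung `(11, 2)`: `WeilTenfoldsSqrtMinus11` (stmt-HodgeConjecture-1262) from `M3` and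
`WeilVariationalHodge`** (`HWA(11, 5)`). [cite: Deligne1982HodgeCycles, proof of Thm. 4.8] -/
theorem weilTenfoldsSqrtMinus11_of_weilVariationalHodge_of_levelStructure
    (hLS : deligne1982_weilFamily_levelStructure) (hV : WeilVariationalHodge) : WeilTenfoldsSqrtMinus11 := by
  intro A φ hA hφ c hrat hH hW
  exact hodgeWeil_of_weilVariationalHodge_of_levelStructure hLS hV 11 (by norm_num) (by norm_num)
    (by norm_num) 5 (by norm_num) A φ hA (by exact_mod_cast hφ) c hrat hH (by exact_mod_cast hW)

/-- **The split child `HyperbolicEightfoldsSqrtMinus7` (stmt-HodgeConjecture-14642) from `M3` and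
`WeilVariationalHodge`** — `HWA(7, 4)` with the hyperbolicity hypothesis forgotten.
[cite: Deligne1982HodgeCycles, proof of Thm. 4.8] -/
theorem hyperbolicEightfoldsSqrtMinus7_of_weilVariationalHodge_of_levelStructure
    (hLS : deligne1982_weilFamily_levelStructure) (hV : WeilVariationalHodge) :
    HyperbolicEightfoldsSqrtMinus7 := by
  intro A φ hA hφ _e _a _ha _ha0 _hhyp c hrat hH hW
  exact hodgeWeil_of_weilVariationalHodge_of_levelStructure hLS hV 7 (by norm_num) (by norm_num) le_rfl
    4 (by norm_num) A φ hA (by exact_mod_cast hφ) c hrat hH (by exact_mod_cast hW)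

/-- **The summit GIVEN the off-sector conjunct**: `M3 → WeilVariationalHodge → SummitOffWeilSector →
HodgeConjecture` — the whole `ℚ(√-p)` Hodge–Weil sector (`p ≡ 3 (4)`, `p ≥ 7`, every dimension, every
discriminant) is `hodgeWeil_of_weilVariationalHodge_of_levelStructure`, and `SummitOffWeilSector`
(stmt-HodgeConjecture-14374, conjecture-grade) is by definition the rest.  A `closes`-shaped statement of
the route's standing with the rung cruxes, `HeckePrymAnchors`, `ProductDescent` and `WeilDescending`
all eliminated. [cite: Deligne1982HodgeCycles, proof of Thm. 4.8] [cite: Grothendieck1966, footnote 13] -/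
theorem hodgeConjecture_of_levelStructure_of_weilVariationalHodge_of_offWeilSector
    (hLS : deligne1982_weilFamily_levelStructure) (hV : WeilVariationalHodge)
    (hOff : SummitOffWeilSector) : _root_.HodgeConjecture :=
  hOff (fun p hp hp4 hp7 n hn A φ hA hφ c hrat hH hW =>
    hodgeWeil_of_weilVariationalHodge_of_levelStructure hLS hV p hp hp4 hp7 n hn A φ hA hφ c hrat hH hW)

end Summit.HodgeConjecture.HodgeConjecture.Theorems.HeckePrymWeilLine

end
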